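import Literature.Geometry.Lorentzian.KerrHyperboloidalLeaves
import Literature.Geometry.Lorentzian.KerrDataProofs
import Literature.Geometry.Lorentzian.KerrSchildCoord
import Literature.Geometry.Lorentzian.SecondFundamentalFormSymm
import Literature.Geometry.Lorentzian.MeanCurvatureRegularity
import Literature.Geometry.Lorentzian.IsometryProofs
import Literature.Geometry.Lorentzian.LeviCivitaProofs
import Literature.Geometry.Lorentzian.ChartCalculus
import Mathlib.Analysis.Calculus.ContDiff.FiniteDimension
import HarnessLib

/-!
# Discharge of `Kerr.SliceFacts`: the Kerr–Schild slice data need no standing hypothesis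

`KerrData.lean` bundles as the `Prop`-class `Kerr.SliceFacts` (instance hypothesis of `Kerr.data`
and of every statement about Kerr initial data in the tree) six named facts about the slice
`{t* = 0} ∩ {r > max r₀ 0}`. Four of them are already theorems (`Kerr.isConnected_slice_holds`,
`PseudoRiemannianMetric.contMDiff_pullbackBilin_holds`,
`PseudoRiemannianMetric.isCovariantDerivativeOn_leviCivitaFun_holds`,
`Kerr.isSpacelikeImmersion_sliceEmbed_holds`). This file proves the remaining two and assembles the
instance:

* `Kerr.contMDiff_sliceNormal_lift` — the future unit normal `ν = (1 + 2H)^{-1/2} V` of the slice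
  has a `C^∞` lift `y ↦ ((0, y), ν y) ∈ T(Kerr.region a r₀)` along the slice embedding (`M ≥ 0`;
  the components are smooth functions of `y` wherever `r > 0`, Cook 2000, §3.2.2);
* `Kerr.sliceK_symm_holds` — **discharge of `Kerr.sliceK_symm`**: the second fundamental form of
  the slice is symmetric (O'Neill 1983, Ch. 4, Lemma 4.4, through the tree's
  `secondFundamentalForm_symm_holds`);
* `Kerr.contMDiff_sliceK_holds` — **discharge of `Kerr.contMDiff_sliceK`**: `y ↦ k_y` is a smooth
  section of the bundle of bilinear forms (O'Neill 1983, Ch. 4, Lemma 4: the shape tensor is a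
  smooth tensor field; through `contMDiffAt_secondFundamentalForm_apply` for the components and
  `OpensChart.contMDiffAt_bilinSection_iff` + `contDiffOn_clm_apply`);
* `Kerr.sliceFacts_holds : Kerr.SliceFacts`, so that users of `Kerr.data M a r₀ hM` may write
  `haveI := Kerr.sliceFacts_holds` and keep no hypothesis beyond `[Kerr.Facts]` (itself a theorem:
  `Kerr.isConnected_region_holds`, `Kerr.contMDiff_bilin_holds`, `Kerr.contMDiff_timeVector_holds`,
  assembled e.g. as `Summit.FinalStateConjecture.FinalStateConjecture.Theorems.SwallowTheDatum.kerrFacts`).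
  No global instances are declared here (theorems only).

## References

* B. O'Neill, *Semi-Riemannian geometry with applications to relativity*, Academic Press 1983,
  Ch. 4, Lemma 4 (p. 100) and Lemma 4.4.
* G. B. Cook, *Initial data for numerical relativity*, Living Rev. Relativ. 3 (2000) 5, §3.2.2,
  (55)–(57).
-/

noncomputable section

open Bundle TopologicalSpace Manifold Set
open scoped ContDiff Topology

namespace Literature.Geometry.Lorentzian

namespace Kerr

/-! ### The unit normal has a smooth lift -/

/-- The coordinate representative of the slice normal,
`N(y) = (1 + 2H(0, y))^{-1/2} V(0, y)`, is `C^n` at every `y` with `r(a, (0, y)) > 0`, for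
`M ≥ 0` (then `1 + 2H > 0`). Cook 2000, §3.2.2 (lapse `(1 + 2H)^{-1/2}`). [cite: Cook2000, §3.2.2] -/
theorem contDiffAt_sliceNormalRep {M : ℝ} (hM : 0 ≤ M) (a : ℝ) {y : E3}
    (hy : 0 < radius a (E4.ofTimeSpace 0 y)) {n : WithTop ℕ∞} :
    ContDiffAt ℝ n (fun y : E3 ↦ (√(1 + 2 * scalarH M a (E4.ofTimeSpace 0 y)))⁻¹ •
      timeVector M a (E4.ofTimeSpace 0 y)) y := by
  have hO : ContDiff ℝ n (E4.ofTimeSpace 0) :=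
    contMDiff_iff_contDiff.mp (E4.contMDiff_ofTimeSpace 0 n)
  have hT : ContDiffAt ℝ n (fun y : E3 ↦ timeVector M a (E4.ofTimeSpace 0 y)) y :=
    (contDiffAt_timeVector M a hy).comp y hO.contDiffAt
  have hH : ContDiffAt ℝ n (fun y : E3 ↦ scalarH M a (E4.ofTimeSpace 0 y)) y :=
    (contDiffAt_scalarH M a hy).comp y hO.contDiffAt
  have hpos : 0 < 1 + 2 * scalarH M a (E4.ofTimeSpace 0 y) := by
    linarith [scalarH_nonneg hM a (E4.ofTimeSpace 0 y)]
  have hS : ContDiffAt ℝ n (fun y : E3 ↦ (√(1 + 2 * scalarH M a (E4.ofTimeSpace 0 y)))⁻¹) y :=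
    ((contDiffAt_const.add (contDiffAt_const.mul hH)).sqrt hpos.ne').inv
      (Real.sqrt_pos.2 hpos).ne'
  exact hS.smul hT

/-- **The future unit normal of the Kerr–Schild slice has a `C^∞` lift** along the slice
embedding: `y ↦ ((0, y), ν y)` is a smooth map `Kerr.slice a r₀ → T(Kerr.region a r₀)`, for
`M ≥ 0`. In the identity trivialisation of `T(Kerr.region a r₀)` (`OpensChart.trivializationAt_apply`)
this is the smoothness of the base map `y ↦ (0, y)` and of the representative
`(1 + 2H)^{-1/2} V` (`contDiffAt_sliceNormalRep`). Cook 2000, §3.2.2. [cite: Cook2000, §3.2.2] -/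
theorem contMDiff_sliceNormal_lift (M a r₀ : ℝ) (hM : 0 ≤ M) :
    ContMDiff 𝓘(ℝ, E3) 𝓘(ℝ, E4).tangent ∞
      (fun y : slice a r₀ ↦
        (TotalSpace.mk' E4 (sliceEmbed a r₀ y) (sliceNormal M a r₀ y) :
          TangentBundle 𝓘(ℝ, E4) (region a r₀))) := by
  intro y
  rw [ModelWithCorners.tangent, contMDiffAt_totalSpace]
  refine ⟨contMDiff_sliceEmbed a r₀ ∞ y, ?_⟩
  have h : (fun x : slice a r₀ ↦ (trivializationAt E4 (TangentSpace 𝓘(ℝ, E4))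
      (sliceEmbed a r₀ y) (TotalSpace.mk' E4 (sliceEmbed a r₀ x) (sliceNormal M a r₀ x) :
        TangentBundle 𝓘(ℝ, E4) (region a r₀))).2) =
      fun x : slice a r₀ ↦ ((√(1 + 2 * scalarH M a (E4.ofTimeSpace 0 (x : E3))))⁻¹ •
        timeVector M a (E4.ofTimeSpace 0 (x : E3)) : E4) := by
    funext x
    exact (congrArg Prod.snd (OpensChart.trivializationAt_apply (sliceEmbed a r₀ y)
      (sliceEmbed a r₀ x) (sliceNormal M a r₀ x))).trans rfl
  rw [h]
  exact (OpensChart.contMDiffAt_iff y _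
    (fun y : E3 ↦ (√(1 + 2 * scalarH M a (E4.ofTimeSpace 0 y)))⁻¹ •
      timeVector M a (E4.ofTimeSpace 0 y)) (fun _ ↦ rfl)).mpr
    (contDiffAt_sliceNormalRep hM a
      (radius_pos_of_mem_region (mem_slice_iff_ofTimeSpace_mem_region.1 y.2)))

/-! ### Symmetry of `k` -/

/-- **Discharge of the named fact `Kerr.sliceK_symm`** (field of `Kerr.SliceFacts`): for `M ≥ 0`
the second fundamental form of the Kerr–Schild slice is symmetric — the slice embedding is `C^∞`,
the normal `ν` is a genuine normal field (`isFutureUnitNormal_sliceNormal_holds`) with `C^∞` lift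
(`contMDiff_sliceNormal_lift`), and every point of the open slice is interior, so the tree's
`secondFundamentalForm_symm_holds` applies. O'Neill 1983, Ch. 4, Lemma 4.4; Wald 1984, §10.2.
[cite: ONeill1983, Ch. 4, Lemma 4.4] -/
theorem sliceK_symm_holds [Facts] (M a r₀ : ℝ) : sliceK_symm M a r₀ := by
  intro hM _ y v w
  have hsymm := PseudoRiemannianMetric.secondFundamentalForm_symm_holds
    (g := (smoothMetric M a r₀).toPseudoRiemannianMetric) (I' := 𝓘(ℝ, E3)) (N := slice a r₀)
    (contMDiff_sliceEmbed a r₀ 2) (isFutureUnitNormal_sliceNormal_holds M a r₀ hM).1.isNormalTo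
    ((contMDiff_sliceNormal_lift M a r₀ hM).of_le (by exact_mod_cast le_top)) (y := y)
    BoundarylessManifold.isInteriorPoint
  rw [sliceK_apply, sliceK_apply]
  exact hsymm.eq v w

/-! ### Smoothness of `k` -/

/-- The components `y ↦ k_y(v, w)` of the second fundamental form of the slice against constant
vectors are `C^∞` functions on the slice (`contMDiffAt_secondFundamentalForm_apply` with the smooth
slice embedding, the smooth lift of `ν` and constant — hence smooth — vector fields). O'Neill 1983,
Ch. 4, Lemma 4 (the shape tensor is a smooth tensor field). [cite: ONeill1983, Ch. 4, Lemma 4] -/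
theorem contMDiffAt_sliceK_apply [Facts] (M a r₀ : ℝ) (hM : 0 ≤ M)
    [(smoothMetric M a r₀).HasLeviCivita]
    (v w : E3) (y : slice a r₀) :
    ContMDiffAt 𝓘(ℝ, E3) 𝓘(ℝ, ℝ) ∞ (fun y : slice a r₀ ↦ sliceK M a r₀ y v w) y := by
  have hV := fun u : E3 ↦ (OpensChart.contMDiffAt_section_iff (n := ∞) y
    (fun x : slice a r₀ ↦ (u : TangentSpace 𝓘(ℝ, E3) x))).mpr contMDiffAt_const
  have h := PseudoRiemannianMetric.contMDiffAt_secondFundamentalForm_apply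
    (g := (smoothMetric M a r₀).toPseudoRiemannianMetric) (I' := 𝓘(ℝ, E3))
    (contMDiff_sliceEmbed a r₀ ∞) (contMDiff_sliceNormal_lift M a r₀ hM)
    (V := fun _ : slice a r₀ ↦ v) (W := fun _ : slice a r₀ ↦ w) (y₀ := y) (hV v) (hV w)
  simpa only [sliceK_apply] using h

/-- **Discharge of the named fact `Kerr.contMDiff_sliceK`** (field of `Kerr.SliceFacts`): for
`M ≥ 0`, `y ↦ k_y` is a `C^∞` section of the bundle of bilinear forms on `T(Kerr.slice a r₀)`.
By `OpensChart.contMDiffAt_bilinSection_iff` this is ordinary smoothness of the representative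
`y ↦ k_y : E3 → (E3 →L E3 →L ℝ)` (extended by `0` off the slice), which by
`contDiffOn_clm_apply` (finite-dimensional source) reduces to the smoothness of the components
`y ↦ k_y(v, w)` (`contMDiffAt_sliceK_apply`). O'Neill 1983, Ch. 4, Lemma 4; Cook 2000, §3.2.2,
(57). [cite: ONeill1983, Ch. 4, Lemma 4] -/
theorem contMDiff_sliceK_holds [Facts] (M a r₀ : ℝ) : contMDiff_sliceK M a r₀ := by
  classical
  intro hM _ y
  -- the representative, extended by zero off the (open) slice
  set G : E3 → E3 →L[ℝ] E3 →L[ℝ] ℝ :=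
    fun z ↦ if h : z ∈ slice a r₀ then sliceK M a r₀ ⟨z, h⟩ else 0 with hG
  have hrep : ∀ z : slice a r₀, sliceK M a r₀ z = G z := fun z ↦ by
    rw [hG]
    simp only [SetLike.coe_mem, ↓reduceDIte]
  rw [OpensChart.contMDiffAt_bilinSection_iff y _ G hrep]
  -- smoothness on the open slice, componentwise
  have hopen : IsOpen (slice a r₀ : Set E3) := (slice a r₀).isOpen
  suffices hOn : ContDiffOn ℝ ∞ G (slice a r₀ : Set E3) from
    hOn.contDiffAt (hopen.mem_nhds y.2)
  refine contDiffOn_clm_apply.mpr fun v ↦ contDiffOn_clm_apply.mpr fun w ↦ ?_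
  intro z hz
  refine ContDiffAt.contDiffWithinAt ?_
  have hz' := contMDiffAt_sliceK_apply M a r₀ hM v w ⟨z, hz⟩
  exact (OpensChart.contMDiffAt_iff (⟨z, hz⟩ : slice a r₀)
    (fun u : slice a r₀ ↦ sliceK M a r₀ u v w) (fun z ↦ G z v w)
    (fun u ↦ congrArg (fun B : E3 →L[ℝ] E3 →L[ℝ] ℝ ↦ B v w) (hrep u))).mp hz'

/-! ### The instance -/

/-- **`Kerr.SliceFacts` holds**: every field is a theorem (`isConnected_slice_holds`,
`contMDiff_pullbackBilin_holds`, `isCovariantDerivativeOn_leviCivitaFun_holds`,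
`isSpacelikeImmersion_sliceEmbed_holds`, `sliceK_symm_holds`, `contMDiff_sliceK_holds`).
Cook 2000, §3.2.2, (55)–(57); O'Neill 1983, Ch. 3, Thm. 3.11 and Ch. 4, Lemma 4.4.
[cite: Cook2000, §3.2.2 (55)–(57)] -/
theorem sliceFacts_holds : SliceFacts where
  isConnected_slice := isConnected_slice_holds
  contMDiff_pullbackBilin _ _ := PseudoRiemannianMetric.contMDiff_pullbackBilin_holds
  isCovariantDerivativeOn_leviCivitaFun _ _ _ :=
    PseudoRiemannianMetric.isCovariantDerivativeOn_leviCivitaFun_holds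
  isSpacelikeImmersion_sliceEmbed := isSpacelikeImmersion_sliceEmbed_holds
  sliceK_symm := sliceK_symm_holds
  contMDiff_sliceK := contMDiff_sliceK_holds

end Kerr

end Literature.Geometry.Lorentzian

end
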